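import Literature.Computability.Complexity.PaulPippengerSzemerediTrotter1983
import Literature.Computability.Complexity.PaulPippengerSzemerediTrotter1983Collapse
import Literature.Computability.Complexity.PaulPippengerSzemerediTrotter1983Padding
import Literature.Computability.Complexity.PaulPippengerSzemerediTrotter1983LogStar
import Literature.Computability.Complexity.DiagMachine
import HarnessLib

/-!
# Paul–Pippenger–Szemerédi–Trotter 1983, §4: `NTIME(n) ⊄ DTIME(n)` from the four-alternation speed-up

Literature / complexity. Inline formalization (D-0026: theorems only, no new named fact) of the
SHELL of the proof of the named fact `PaulEtAl1983_NTIME_not_subset_DTIME`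
(`PaulPippengerSzemerediTrotter1983.lean`): everything in the printed argument except its one
deep lemma, the speed-up of deterministic time by four alternations, which enters the main
theorem below as an explicit hypothesis.

The printed proof (PPST 1983; restated in Santhanam 2001, §1–2 and Wagner–Wechsung 1986,
Thm. 24.6.10) has four ingredients:

1. **Speed-up** (PPST, via the segregator theorem for multi-pushdown graphs and block-respecting
   simulation): `DTIME(t) ⊆ Σ₄TIME(t / log* t)` for time-constructible `t(n) ≥ n log* n`
   (Santhanam 2001, §2, p. 3: "[24] actually proves that `DTIME(t)` is contained in `Σ₄(o(t))`";
   Prop. 2.4; Wagner–Wechsung: "simulating a given 1T-DM that works within time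
   `t(n) ≥ n log* n` … by an alternating machine that works within time `t(n)/log* t(n)` and
   makes 4 alternations"). NOT formalized; it is the hypothesis `hspeed` below, read at ONE
   superlinear level `g` (for `g(n) = n log* n` the printed bound `g / log* g ≤ n` lands in the
   linear level `Σ₄TIME(n) = sigmaLin 4` of `…Collapse.lean`).
2. **Collapse lemma**: `NTIME(n) ⊆ DTIME(n) ⟹ ΣₖTIME(n) ⊆ DTIME(n)` — PROVED,
   `sigmaLin_subset_DTIME_id_of_collapse` (`…Collapse.lean`).
3. **Translation (padding)**: `NTIME(n) ⊆ DTIME(n) ⟹ NTIME(g) ⊆ DTIME(g)` — PROVED,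
   `NTIME_subset_DTIME_of_linear_collapse` (`…Padding.lean`), for `g ≥ id` whose binary value is
   computable from `1ⁿ` in linear time.
4. **Hierarchy**: PPST contradict the hierarchy theorem for alternating (here: nondeterministic)
   linear versus slightly superlinear time — PROVED in the tree in Žák's tight form,
   `Diag.ntime_hierarchy_holds` (`DiagMachine.lean`): `f(n+1) = o(g(n))`, both time constructible,
   gives `NTIME g ⊄ NTIME f`; with `f = id` (`isTimeConstructible_id`, `…Clocks.lean`).

Assembly (**`PaulEtAl1983_NTIME_not_subset_DTIME_of_speedup`**): if `NTIME(n) ⊆ DTIME(n)` then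
`NTIME(g) ⊆(3) DTIME(g) ⊆(1) Σ₄TIME(n) ⊆(2) DTIME(n) ⊆ NTIME(n)` (`DTIME_id_subset_NTIME_id`),
contradicting (4) since `n + 1 = o(g(n))`. Hence the fact follows from the speed-up at any one
level `g` with: `1ⁿ ↦ bin (g n)` in linear time, `g ≥ id`, `n + 1 = o(g n)`, `DTIME g ⊆ sigmaLin 4`.
PPST's level is `t(n) = n log* n`: the three routine properties are PROVED in `…LogStar.lean` for
`logStarLevel n = n · 2^{size (log* n) - 1}` (the level rounded down to a shift, so that its
numeral needs no multiplication), giving the concrete forms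
**`PaulEtAl1983_NTIME_not_subset_DTIME_of_speedup_logStarLevel`** (hypothesis
`DTIME logStarLevel ⊆ sigmaLin 4`) and **`PaulEtAl1983_NTIME_not_subset_DTIME_of_speedup_logStar`**
(hypothesis `DTIME (fun n => n * (logStar n + 1)) ⊆ sigmaLin 4`, by `DTIME_mono`), the latter
being the printed speed-up `DTIME(t) ⊆ Σ₄TIME(t / log* t)` read at `t = n (log* n + 1)` over the
tree's classes (`t / log* t ≤ 2n` there, and `Σ₄TIME(O(n)) = sigmaLin 4`).

Remaining debt of the fact after this file: exactly ingredient 1 (a machine-and-combinatorics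
construction over Mathlib's `FinTM2`: computation graphs of multi-stack runs are multi-pushdown
graphs `H_r(N)` — Santhanam 2001, §1, p. 2 —, these have `(N/log* N)`-segregators of size
`N/log* N` — PPST; Santhanam 2001, §2, p. 4 —, and a `Σ₄` linear-time verifier re-simulates the
blocks outside a guessed segregator).

## References

* W. J. Paul, N. Pippenger, E. Szemerédi, W. T. Trotter, *On determinism versus non-determinism
  and related problems*, 24th FOCS (1983) 429–438 [PaulEtAl1983].
* R. Santhanam, *On separators, segregators and time versus space*, CCC 2001, 286–294, §1
  (p. 1), §2 (pp. 3–4: Prop. 2.4, Lemma 2.3, the segregator bound of [24]) [Santhanam2001].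
* K. Wagner, G. Wechsung, *Computational Complexity*, Reidel 1986, Thm. 22.5.5 and
  Thm. 24.6.10 with its proof sketch [WagnerWechsung1986].
* S. Žák, *A Turing machine time hierarchy*, TCS 26 (1983) 327–333 [Zak1983]; S. Homer,
  A. L. Selman, *Computability and Complexity Theory*, 2nd ed., Springer 2011, §5.2 and p. 115
  [HomerSelman2011].
-/

namespace Literature.Computability.Complexity

open _root_.Computability Turing Filter Asymptotics

/-- **PPST 1983, §4 — nondeterministic linear time is not deterministic linear time, from the
four-alternation speed-up at one superlinear level.** Let `g : ℕ → ℕ` be a bound with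
`1ⁿ ↦ bin (g n)` computable in linear time (`hG`), `g n ≥ n` (`hid`) and `n + 1 = o(g n)`
(`hsuper`; e.g. `g n = n log* n`), and assume PPST's speed-up at that level, read over the tree's
classes: `DTIME(g) ⊆ Σ₄TIME(n)` (`hspeed`, `sigmaLin 4` of `…Collapse.lean`; for `g = n log* n`
this is the printed `DTIME(t) ⊆ Σ₄TIME(t/log* t)` at `t = g`). Then
`¬ (NTIME(n) ⊆ DTIME(n))`: otherwise `NTIME(g) ⊆ DTIME(g)` (translation,
`NTIME_subset_DTIME_of_linear_collapse`) `⊆ Σ₄TIME(n)` (speed-up) `⊆ DTIME(n)` (collapse,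
`sigmaLin_four_subset_DTIME_id_of_collapse`) `⊆ NTIME(n)` (`DTIME_id_subset_NTIME_id`),
contradicting the nondeterministic time hierarchy theorem `Diag.ntime_hierarchy_holds` with
`f = id` (`isTimeConstructible_id`) and `g` (`isTimeConstructible_of_linear_binary`).
[cite: PaulEtAl1983, §4 (main theorem from the speed-up, collapse and hierarchy)]
[cite: Santhanam2001, §2 (p. 3: "[24] actually proves DTIME(t) ⊆ Σ₄(o(t)). A collapse lemma is then used … contradiction to the hierarchy theorem")]
[cite: WagnerWechsung1986, Thm. 24.6.10 (proof sketch)] -/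
theorem PaulEtAl1983_NTIME_not_subset_DTIME_of_speedup {g : ℕ → ℕ} {c : ℕ}
    (hG : TimeComputable unaryEncodeNat encodeNat g fun n => c * n + c) (hid : ∀ n, n ≤ g n)
    (hsuper : (fun n => ((n + 1 : ℕ) : ℝ)) =o[atTop] fun n => (g n : ℝ))
    (hspeed : DTIME g ⊆ sigmaLin 4) :
    PaulEtAl1983_NTIME_not_subset_DTIME := by
  intro hcollapse
  have h1 : NTIME g ⊆ DTIME g := NTIME_subset_DTIME_of_linear_collapse hG hid hcollapse
  have h2 : sigmaLin 4 ⊆ DTIME (fun n => n) := sigmaLin_four_subset_DTIME_id_of_collapse hcollapse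
  have h3 : DTIME (fun n => n) ⊆ NTIME (fun n => n) := DTIME_id_subset_NTIME_id
  have hsub : NTIME g ⊆ NTIME (fun n => n) := h1.trans (hspeed.trans (h2.trans h3))
  exact Diag.ntime_hierarchy_holds (fun n => n) g isTimeConstructible_id
    (isTimeConstructible_of_linear_binary hG hid) hsuper hsub

/-- **The same with the speed-up into any level `Σₖ`** (Gupta's `Σ₂` refinement of PPST's
simulation, Santhanam 2001, §1: "Gupta [10] showed that the simulation could in fact be done by
`Σ₂` machines", is covered by `k = 2`): under `hG`, `hid`, `hsuper`, a speed-up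
`DTIME(g) ⊆ ΣₖTIME(n)` for ANY `k` refutes `NTIME(n) ⊆ DTIME(n)`, the collapse lemma holding
at every level. [cite: Santhanam2001, §1 (p. 1) and §2 (Prop. 2.4)] [cite: PaulEtAl1983, §4] -/
theorem PaulEtAl1983_NTIME_not_subset_DTIME_of_speedup_level {g : ℕ → ℕ} {c : ℕ} (k : ℕ)
    (hG : TimeComputable unaryEncodeNat encodeNat g fun n => c * n + c) (hid : ∀ n, n ≤ g n)
    (hsuper : (fun n => ((n + 1 : ℕ) : ℝ)) =o[atTop] fun n => (g n : ℝ))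
    (hspeed : DTIME g ⊆ sigmaLin k) :
    PaulEtAl1983_NTIME_not_subset_DTIME := by
  intro hcollapse
  have h1 : NTIME g ⊆ DTIME g := NTIME_subset_DTIME_of_linear_collapse hG hid hcollapse
  have h2 : sigmaLin k ⊆ DTIME (fun n => n) := sigmaLin_subset_DTIME_id_of_collapse hcollapse k
  have h3 : DTIME (fun n => n) ⊆ NTIME (fun n => n) := DTIME_id_subset_NTIME_id
  have hsub : NTIME g ⊆ NTIME (fun n => n) := h1.trans (hspeed.trans (h2.trans h3))
  exact Diag.ntime_hierarchy_holds (fun n => n) g isTimeConstructible_id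
    (isTimeConstructible_of_linear_binary hG hid) hsuper hsub

/-- **PPST's own level.** The fact follows from the four-alternation speed-up at the level
`logStarLevel n = n · 2^{size (log* n) - 1} ≤ n · max 1 (log* n)` (`…LogStar.lean`:
`timeComputable_logStarLevel`, `le_logStarLevel`, `isLittleO_succ_logStarLevel` discharge the
three routine hypotheses of `PaulEtAl1983_NTIME_not_subset_DTIME_of_speedup`).
[cite: PaulEtAl1983, §4] [cite: Santhanam2001, §2 (Prop. 2.4 at t = n log* n)] -/
theorem PaulEtAl1983_NTIME_not_subset_DTIME_of_speedup_logStarLevel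
    (hspeed : DTIME logStarLevel ⊆ sigmaLin 4) : PaulEtAl1983_NTIME_not_subset_DTIME :=
  PaulEtAl1983_NTIME_not_subset_DTIME_of_speedup timeComputable_logStarLevel le_logStarLevel
    isLittleO_succ_logStarLevel hspeed

/-- **PPST 1983 — `NTIME(n) ⊄ DTIME(n)` from the printed speed-up lemma at `t = n (log* n + 1)`.**
The one remaining hypothesis is PPST's Theorem "`DTIME(t) ⊆ Σ₄TIME(t / log* t)` for
time-constructible `t(n) ≥ n log* n`" (Wagner–Wechsung 1986, proof of Thm. 24.6.10; Santhanam
2001, Prop. 2.4 in Gupta's `Σ₂` form) read at `t(n) = n (log* n + 1)` over the tree's classes: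
there `t / log* t ≤ 2n`, so the simulating class is the linear level `Σ₄TIME(n) = sigmaLin 4`
(`…Collapse.lean`), and the hypothesis reads `DTIME (fun n => n * (logStar n + 1)) ⊆ sigmaLin 4`.
Since `logStarLevel n ≤ n (log* n + 1)` (`logStarLevel_le`), `DTIME_mono` reduces to
`PaulEtAl1983_NTIME_not_subset_DTIME_of_speedup_logStarLevel`. Everything else in the printed
proof — collapse, translation, hierarchy, the constructibility of the level — is proved in the
tree. [cite: PaulEtAl1983, §4 (main theorem) and the speed-up theorem DTIME(t) ⊆ Σ₄TIME(t/log* t)]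
[cite: WagnerWechsung1986, Thm. 24.6.10 (proof sketch: 4 alternations, time t/log* t)]
[cite: Santhanam2001, §2 (p. 3 and Prop. 2.4)] -/
theorem PaulEtAl1983_NTIME_not_subset_DTIME_of_speedup_logStar
    (hspeed : DTIME (fun n => n * (logStar n + 1)) ⊆ sigmaLin 4) :
    PaulEtAl1983_NTIME_not_subset_DTIME :=
  PaulEtAl1983_NTIME_not_subset_DTIME_of_speedup_logStarLevel
    ((DTIME_mono fun n => (logStarLevel_le n).trans
      (Nat.mul_le_mul_left n (max_le (Nat.succ_pos _) (Nat.le_succ _)))).trans hspeed)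

/-! ### Calibration: `Σ₁TIME(n) = NTIME(n)` -/

/-- **`NTIME(n) ⊆ Σ₁TIME(n)`**: a presentation `(c, R, M)` of `L ∈ NTIME(n)` (the tree's
one-constant verifier form) is a linearly bounded existential quantifier over the pair language
`L' = {w | R x (y ↾ (c|x| + c))}` (`x = (boolUnpair w).1`, `y = readRest w`), which is in
`DTIME(n)`: its decider CUTS the second component at the window (`truncMapAux` over the window
clock, `exists_window_clock`; half a step per discarded symbol) and then runs `M`, which is
specified on the cut pair. With `sigmaLin_one_subset_NTIME_id` this calibrates the hierarchy of
`…Collapse.lean`: `sigmaLin 1 = NTIME(n)` (`sigmaLin_one_eq_NTIME_id`).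
[cite: AroraBarakCC2009, Def. 2.1 and Thm. 2.6 (verifier form)] [cite: PaulEtAl1983, §4] -/
theorem NTIME_id_subset_sigmaLin_one : NTIME (fun n => n) ⊆ sigmaLin 1 := by
  rintro L ⟨c, R, M, hM, hL⟩
  rw [sigmaLin_succ, piLin_zero]
  obtain ⟨N, e, hN⟩ := exists_window_clock c
  let W : List Bool → ℕ := fun x => c * x.length + c
  let L' : Language Bool :=
    {w | R (boolUnpair w).1 ((PairFstTM.readRest w).take (W (boolUnpair w).1)) = true}
  have hmem : ∀ w, w ∈ L' ↔
      R (boolUnpair w).1 ((PairFstTM.readRest w).take (W (boolUnpair w).1)) = true := fun w => Iff.rfl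
  refine ⟨L', ⟨e + 5 * c + 16, (truncMapAux N).comp M, fun w => ?_⟩, c, fun x => ?_⟩
  · -- the decider of `L'`
    set x := (boolUnpair w).1 with hx
    set y := PairFstTM.readRest w with hy
    have hlen := Com.length_readRest_add_le w
    rw [← hx, ← hy] at hlen
    have h₁ := outputsWithin_truncMapAux N (z := w) (a := x)
      (u := List.replicate (c * x.length + c) true) (m := e * x.length + e) (by rw [← hx]; exact hN x)
    rw [← hy, List.length_replicate] at h₁
    set y' := y.take (c * x.length + c) with hy'
    have hlen' : y'.length ≤ c * x.length + c := List.length_take_le _ _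
    have h₂ : M.OutputsWithin (boolPair x y') (encodeBool (R x y')) (c * x.length + c) :=
      hM x y' hlen'
    have hind : L'.boolIndicator w = R x y' := by
      have h1 : (L' : Set (List Bool)).boolIndicator w = true ↔ w ∈ L' :=
        (Set.mem_iff_boolIndicator (L' : Set (List Bool)) w).symm
      rw [Bool.eq_iff_iff, h1, hmem]
    have h := Turing.TM2ComputableAux.comp_outputsWithin _ _ h₁ h₂
    simp only [id]
    rw [hind]
    refine h.mono ?_
    have hyw : y.length ≤ w.length := by omega
    have hxw : x.length ≤ w.length := by omega
    have hy2 : y.length / 2 ≤ y.length := Nat.div_le_self _ _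
    nlinarith [hyw, hxw, hy2, Nat.zero_le (e * w.length), Nat.zero_le (c * w.length),
      Nat.sub_le w.length y.length]
  · -- membership: the admissible witnesses are exactly those of the presentation
    rw [hL x]
    constructor
    · rintro ⟨y, hy, hR⟩
      refine ⟨y, hy, ?_⟩
      rw [hmem]
      change R (boolUnpair (boolPair x y)).1 ((PairFstTM.readRest (boolPair x y)).take
        (c * (boolUnpair (boolPair x y)).1.length + c)) = true
      rw [boolUnpair_boolPair, readRest_boolPair]
      dsimp only
      rw [List.take_of_length_le hy]
      exact hR
    · rintro ⟨y, hy, hw⟩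
      refine ⟨y, hy, ?_⟩
      rw [hmem] at hw
      change R (boolUnpair (boolPair x y)).1 ((PairFstTM.readRest (boolPair x y)).take
        (c * (boolUnpair (boolPair x y)).1.length + c)) = true at hw
      rw [boolUnpair_boolPair, readRest_boolPair] at hw
      dsimp only at hw
      rw [List.take_of_length_le hy] at hw
      exact hw

/-- **`Σ₁TIME(n) = NTIME(n)`** over the tree's classes. [cite: PaulEtAl1983, §4] -/
theorem sigmaLin_one_eq_NTIME_id : sigmaLin 1 = NTIME (fun n => n) :=
  Set.Subset.antisymm sigmaLin_one_subset_NTIME_id NTIME_id_subset_sigmaLin_one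

/-- **`DTIME(n)` is closed under the first projection**: `{w | (boolUnpair w).1 ∈ L} ∈ DTIME(n)`
for `L ∈ DTIME(n)` (run the decider behind the pair reader, `boolUnpairFstLift`).
[cite: AroraBarakCC2009, Claim 2.4 (the verifier ignores the certificate)] -/
theorem fst_preimage_mem_DTIME_id {L : Language Bool} (hL : L ∈ DTIME (fun n => n)) :
    {w | (boolUnpair w).1 ∈ L} ∈ DTIME (fun n => n) := by
  obtain ⟨a, hdec⟩ := hL
  obtain ⟨M, hM⟩ := (hdec : TimeDecidable id L fun n => a * n + a)
  refine ⟨a + 4, boolUnpairFstLift M, fun w => ?_⟩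
  have hl := Com.length_readRest_add_le w
  have h := outputsWithin_boolUnpairFstLift M (z := w) (hM (boolUnpair w).1)
  have hind : ({w | (boolUnpair w).1 ∈ L} : Language Bool).boolIndicator w =
      L.boolIndicator (boolUnpair w).1 := by
    have h1 : ∀ (s : Set (List Bool)) (v : List Bool), s.boolIndicator v = true ↔ v ∈ s :=
      fun s v => (Set.mem_iff_boolIndicator s v).symm
    rw [Bool.eq_iff_iff, h1, h1]
    rfl
  simp only [id] at h ⊢
  rw [hind]
  refine h.mono ?_
  nlinarith [hl, Nat.zero_le (a * w.length)]

/-- **`DTIME(n) ⊆ Σ₁TIME(n)`**: take the empty witness (`c = 0`) over the first-projection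
preimage (the linear twin of `P ⊆ NP`, Arora–Barak 2009, Claim 2.4). [cite: AroraBarakCC2009, Claim 2.4] -/
theorem DTIME_id_subset_sigmaLin_one : DTIME (fun n => n) ⊆ sigmaLin 1 := by
  intro L hL
  rw [sigmaLin_succ, piLin_zero]
  refine ⟨{w | (boolUnpair w).1 ∈ L}, fst_preimage_mem_DTIME_id hL, 0, fun x => ?_⟩
  constructor
  · intro hx
    refine ⟨[], by simp, ?_⟩
    show (boolUnpair (boolPair x [])).1 ∈ L
    simpa using hx
  · rintro ⟨y, hy, hw⟩
    have : y = [] := by simpa using hy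
    subst this
    have hw' : (boolUnpair (boolPair x [])).1 ∈ L := hw
    simpa using hw'

end Literature.Computability.Complexity
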